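import Summits.ResolutionOfSingularities.ResolutionOfSingularities.Theorems.RadicialJungCleanModelsLocalMonomializationAlongCoarsening
import Literature.AlgebraicGeometry.Resolution.RankOneReductionProofs
import HarnessLib

/-!
# SPEC (sorried targets, crux workfile — NOT a Theorems file): the two remaining kernel bricks of the repaired weak-embedded rank-one reduction of `hMono_4`

Crux `CleanModels` (stmt-ResolutionOfSingularities-15917), line `Sketch` rev 35, stub 7.  Seat `decomp-res-hand-2` g4; memo
`Cruxes/CleanModels/Lines/Sketch-memo-hand2-g4-stubs-5-7.md` rev 3, §2b (caveat on NS 2012 §3.2) and §5 items (3d)/(3e).  This file only TYPES the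
two remaining statements so that a successor starts from elaborating targets; both carry `sorry`.  Inputs already landed (all ✓, --supports 15917):
`weakEmbeddedLU_along_properCoarsening_dimLEFour` (step (i)), `weakEmbeddedLU_residueSide_dimLEFour` (step (ii)), `cor217_transport` (NS Cor. 2.17,
transport form), `novacoskiSpivakovsky2014_step_export` (NS §3.1 final step, export form), `blowupAlong_generators_of_centre` (Lemma 2.19 + count for
prescribed `(a, Y)`).

* `spec_absorption` — item (3e): ONE blowing up along `(∏ x_l^{m_l}, Y)` absorbs the `𝔭`-parts of the coefficients: if `𝔭 = (Y)` (as an ideal of the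
  model `A`, `#Y ≤ dim A_𝔭`), `A_𝔮/𝔭` is regular of dimension `t` with regular system of parameters the images of `x₁..x_t ∈ A`, and every `z ∈ Z` is
  `c_z · Y^{γ_z}` with `c_z ≡ u_z · x^{δ_z} (mod 𝔭 A_𝔮)`, `u_z` a unit at `𝔮`, `δ_z ≤ m`, then `A' = A[Y / x^m]` is regular at the centre of `ν` with
  regular system of parameters `(x, Y/x^m)` in which every `z ∈ Z` is a unit times a monomial.  PROOF PLAN: ✓ `blowupAlong_generators_of_centre` with
  `a := ∏ x_l^{m_l}` gives regularity, `𝔭' = (Y/x^m)`, residues unchanged, `A' = A ⊔ k[Y/x^m]`; then `𝔪' = (x, Y')` (decompose `A' = A + (Y')A'`,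
  use `hx𝔪` and `𝔭 ⊆ (Y')A'`), the count `dim = t + #Y'` (✓ `add_le_height_of_le`, ✓ `ringKrullDim_localization_quotient`, `dim A'_{𝔭'} = dim A_𝔭 = #Y`),
  and the computation `c_z = x^{δ_z}(u_z + x^{m-δ_z}·j)`, `j ∈ (Y')`, in `locAtCentre A' O`.
* (3d), prose only (typing deferred): for `A` as above with `locAtCentre A O` regular and `𝔪 = (x, Y)`, a residue-side blowing up at the COORDINATE
  centre `(x̄_l)_{l ∈ S}` lifts to `A' = A[x_l/x_{l₀} (l ∈ S), Y/x_{l₀}]` (`l₀ ∈ S` `ν`-minimal among the `x_l`, automatically `ν`-smaller than every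
  `y ∈ Y` since `ν₁(y) < 1 = ν₁(x_{l₀})`): `A' ⊆ O`, `locAtCentre A' O` regular with parameters `(x_{l₀}, x_l/x_{l₀} (l ∈ S∖l₀), x_l (l ∉ S), Y/x_{l₀})`,
  `𝔭' = (Y/x_{l₀})`, `locAtCentre A' O₁ = locAtCentre A O₁`, residue ring = the residue-side blowing up.  (NS Lemma 2.19 with `a := x_{l₀}` for the
  `𝔭`-part + the standard chart of the blowing up of a regular centre.)  With the SEQUENCE form of embedded resolution in dimension ≤ 3 (memo (3c))
  iterate (3d), then apply `spec_absorption`, then assemble `hMono_4 ⟸ hMono_4^{rank one}`.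
-/

noncomputable section

set_option linter.dupNamespace false

open IsLocalRing
open Literature.AlgebraicGeometry.Resolution

namespace Summit.ResolutionOfSingularities.ResolutionOfSingularities.Theorems.RadicialJung.CleanModels.NS32Spec

variable {k K : Type} [Field k] [Field K] [Algebra k K]

/-- SPEC of memo item (3e) — the ABSORPTION step (see the module docstring for the proof plan).  `sorry`: a TARGET, not a result. [folklore] -/
theorem spec_absorption (O O₁ : ValuationSubring K) (hO : O ≤ O₁)
    (A : Subalgebra k K) (hA : A.toSubring ≤ O.toSubring) (hAfg : A.FG) (hfrac : IsFractionRing A K)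
    -- the centre `𝔭` of `ν₁` on `A` is generated by `Y`, `#Y ≤ dim A_𝔭` (output (β) of `novacoskiSpivakovsky2014_step_export`)
    (Y : Finset A.toSubring)
    (hIY : ((maximalIdeal O₁).comap (Subring.inclusion (hA.trans hO))) = Ideal.span (Y : Set A.toSubring))
    (hYcard : (Y.card : WithBot ℕ∞) ≤ ringKrullDim
      (Localization.AtPrime ((maximalIdeal O₁).comap (Subring.inclusion (hA.trans hO)))))
    -- the residue side: `A_𝔮 / 𝔭` regular of dimension `t`, the images of `x` a regular system of parameters (output of `cor217_transport`)
    (hregQ : IsRegularLocalRing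
      (Localization.AtPrime ((maximalIdeal O).comap (Subring.inclusion hA)) ⧸
        ((maximalIdeal O₁).comap (Subring.inclusion (hA.trans hO))).map
          (algebraMap A.toSubring
            (Localization.AtPrime ((maximalIdeal O).comap (Subring.inclusion hA))))))
    (t : ℕ) (x : Fin t → A.toSubring)
    (hdimt : ringKrullDim
      (Localization.AtPrime ((maximalIdeal O).comap (Subring.inclusion hA)) ⧸
        ((maximalIdeal O₁).comap (Subring.inclusion (hA.trans hO))).map
          (algebraMap A.toSubring
            (Localization.AtPrime ((maximalIdeal O).comap (Subring.inclusion hA))))) = t)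
    (hxQ : ∀ l, O.valuation ((x l : A.toSubring) : K) < 1) (hxP : ∀ l, O₁.valuation ((x l : A.toSubring) : K) = 1)
    (hx𝔪 : ∀ c : A.toSubring, O.valuation (c : K) < 1 →
      ∃ (s : A.toSubring) (b : Fin t → A.toSubring), O.valuation (s : K) = 1 ∧
        O₁.valuation (((s * c - ∑ l, b l * x l : A.toSubring)) : K) < 1)
    -- the data to be monomialized
    (Z : Finset K) (c : K → A.toSubring) (γ : K → A.toSubring → ℕ) (u : K → A.toSubring) (δ : K → Fin t → ℕ) (m : Fin t → ℕ)
    (hz : ∀ z ∈ Z, z = ((c z : A.toSubring) : K) * ∏ y ∈ Y, ((y : A.toSubring) : K) ^ (γ z y))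
    (hu : ∀ z ∈ Z, O.valuation ((u z : A.toSubring) : K) = 1)
    (hcu : ∀ z ∈ Z, ∃ s : A.toSubring, O.valuation (s : K) = 1 ∧
      O₁.valuation (((s * (c z - u z * ∏ l, x l ^ (δ z l)) : A.toSubring)) : K) < 1)
    (hδm : ∀ z ∈ Z, ∀ l, δ z l ≤ m l) :
    ∃ (A' : Subalgebra k K), A'.toSubring ≤ O.toSubring ∧ A ≤ A' ∧ A'.FG ∧
      locAtCentre A'.toSubring O₁ = locAtCentre A.toSubring O₁ ∧
    ∃ (_ : IsRegularLocalRing (locAtCentre A'.toSubring O)) (e : ℕ) (a : Fin e → ↥(locAtCentre A'.toSubring O)),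
      Ideal.span (Set.range a) = IsLocalRing.maximalIdeal ↥(locAtCentre A'.toSubring O) ∧
      ringKrullDim ↥(locAtCentre A'.toSubring O) = (e : WithBot ℕ∞) ∧
      ∀ z ∈ Z, z ≠ 0 → ∃ (v : ↥(locAtCentre A'.toSubring O)) (μ : Fin e → ℕ), IsUnit v ∧
        z = (v : K) * ∏ i, ((a i : ↥(locAtCentre A'.toSubring O)) : K) ^ (μ i) := by
  sorry

end Summit.ResolutionOfSingularities.ResolutionOfSingularities.Theorems.RadicialJung.CleanModels.NS32Spec

end
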